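import Literature.AlgebraicGeometry.Frobenioids.ArithmeticDivisors
import Literature.IUT.HodgeTheaters.ConventionsNumbers
import HarnessLib

/-!
# [IUTchI] Example 3.5 (i) ↔ Example 5.1 (iii): the realification map `Φ(F_mod) → Φ_{𝒞⊩_mod}` (DEFINITION only)

Mochizuki, *Inter-universal Teichmüller theory I*, §3, Example 3.5 (i), kurims manuscript (May 2020) p. 84
([IUTchI] Ex 3.5 (i) p.84) [claim: Mochizuki2012, status: disputed]: `𝒞⊩_mod` is "the realification of the
Frobenioid … of arithmetic line bundles on `S_mod`" [= `†ℱ^⊛_mod`, Ex 5.1 (iii) p. 126]; "`Φ_{𝒞⊩_mod,v} ≅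
ord(𝒪^▷_{(F_mod)_v})^pf ⊗ ℝ_{≥0}`"; "`p_v` determines an element `log⊢_mod(p_v) ∈ Φ_{𝒞⊩_mod,v}`"; §0 p. 35: at
archimedean `v`, `p_v := e`, `log(p_v) = 1`.  abc-iut-L5-t2 types `Φ_{𝒞⊩_mod}` REAL as `V_mod →₀ ℝ_{≥0}` with the
convention `log⊢_mod(p_v) ↦ 1` (`InitialThetaData.PhiMod`/`logMod`); abc-iut-L1 types the divisor monoid of
`†ℱ^⊛_mod` ([FrdI] Ex 6.3) as `EffArithDivisor = (FinitePlace →₀ ℕ) × (InfinitePlace → ℝ_{≥0})` (arithmetic model of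
Ex 5.1, abc-iut-w4-d050 `GlobalDivisorData.arith(Along)`, `arith_field_terminal`).  THIS FILE defines the ONE
comparison map between them — the natural `Φ → Φ^rlf` of [FrdI] Prop 5.3 written in t2's coordinates: at a
finite `v` the coefficient `n` of `[v]` goes to `n / e_v` (`log⊢_mod(p_v) = ord_v(p_v)·[v] = e_v·[v] ↦ 1`), at an
archimedean `v` the coordinate is kept.  Proof-only sequel (not here): the induced map on abc-iut-L1's
realification `Φ(L)^rlf` ([FrdI] Def 2.4 (i)) is an isomorphism onto `PhiMod`, and `realifyMod (div p|_v) = logMod v`.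
No new Prop fact; no statement of the paper is strengthened; no side is taken on [IUTchIII] Cor. 3.12.
-/

noncomputable section

namespace Literature.IUT.HodgeTheaters

open NumberField Literature.AlgebraicGeometry.Frobenioids
open scoped NNReal

variable (L : Type) [Field L] [NumberField L]

/-- `e_v`, the absolute ramification index of the finite place `v` (`ord_v(p_v) = e_v`; the same expression as
abc-iut-L5-t2's `logDPhiCoord`). ([IUTchI] Ex 3.5 (i) p.84) [claim: Mochizuki2012, status: disputed] -/
def absRamIdx (v : FinitePlace L) : ℕ := v.maximalIdeal.asIdeal.ramificationIdx ℤ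

/-- **The realification map `Φ(L) → Φ(L)^rlf = Φ_{𝒞⊩_mod}` in [IUTchI] Ex 3.5 (i)'s coordinates** (`L = F_mod`): an
effective arithmetic divisor `((n_v)_{v ∈ V^non}, (x_v)_{v ∈ V^arc})` ([FrdI] Ex 6.3) goes to the finitely supported
function `v ↦ n_v / e_v` (finite `v`; units `log⊢_mod(p_v) ↦ 1`), `v ↦ x_v` (archimedean `v`; `log(p_v) = 1`) —
the map on divisor monoids underlying "`𝒞⊩_mod` = the realification of `†ℱ^⊛_mod`", landing in abc-iut-L5-t2's
`PhiMod = (V_mod →₀ ℝ_{≥0})`.  An additive monoid homomorphism. ([IUTchI] Ex 3.5 (i) p.84)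
[claim: Mochizuki2012, status: disputed] -/
def EffArithDivisor.realifyMod : EffArithDivisor L →+ (Val L →₀ ℝ≥0) :=
  (Finsupp.liftAddHom fun v : FinitePlace L =>
      (Finsupp.singleAddHom (Sum.inr v : Val L)).comp
        ((AddMonoidHom.mulRight ((absRamIdx L v : ℝ≥0)⁻¹)).comp (Nat.castAddMonoidHom ℝ≥0))).comp
      (AddMonoidHom.fst _ _) +
    ((Finsupp.mapDomain.addMonoidHom (Sum.inl : InfinitePlace L → Val L)).comp
        (Finsupp.addEquivFunOnFinite (ι := InfinitePlace L) (M := ℝ≥0)).symm.toAddMonoidHom).comp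
      (AddMonoidHom.snd _ _)

end Literature.IUT.HodgeTheaters

end
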